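import Summits.SmoothPoincare4.SmoothPoincare4.Theorems.CongruenceShadowsShadowsStandardHelperMaxCharLevel
import Summits.SmoothPoincare4.SmoothPoincare4.Theorems.CongruenceShadowsShadowsStandardHelperVennEvenPerm
import Mathlib.GroupTheory.SpecificGroups.Alternating
import Mathlib.GroupTheory.QuotientGroup.Basic
import HarnessLib

/-!
# Hall-coordinate toolkit for the top-stratum gate — helper `helper_threeCyclesRealised` of line
`prym-layer-stable-rank` for crux `CongruenceShadows.ShadowsStandard` (item stmt-SmoothPoincare4-14593,
route route-SmoothPoincare4-CongruenceShadows)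

Small general lemmas used by the reduction "alternating monodromy ⟹ TopGate"
(`CongruenceShadowsShadowsStandardHelperGateOfMonodromy.lean`):

* `isSimpleGroup_quotient_of_maximal_normal`, `not_isMulCommutative_quotient` — quotients by maximal
  normal subgroups not containing the commutator subgroup are non-abelian simple;
* `exists_mk_eq_mk_eq` — Chinese remainder for two normal subgroups with `P ⊔ P' = ⊤`;
* `maxNormal_map` — automorphisms permute the maximal normal overgroups of a characteristic `M`;
* `vennPerm` — the plain (parity-free) Venn lemma from the landed fibre-count lemmas of
  `helper_vennEvenPerm` (p125485);
* `alternatingGroup_le_of_threeCycles_realised` (= registered `helper_threeCyclesRealised` in `∀`-form)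
  — a subgroup of `Perm β` realising every 3-cycle pointwise contains the alternating group
  (`Equiv.Perm.closure_three_cycles_eq_alternating`);
* `eq_top_of_card_le_two_of_transitive` — on at most two points a transitive subgroup is everything.

The file declares theorems only.
-/

set_option linter.dupNamespace false

noncomputable section

namespace Summit.SmoothPoincare4.SmoothPoincare4.Theorems.ShadowsStandard.PrymLayerStableRank

open Subgroup

section General

variable {G : Type} [Group G]

/-- The quotient by a maximal proper normal subgroup is a simple group. [folklore] -/
theorem isSimpleGroup_quotient_of_maximal_normal (P : Subgroup G) [P.Normal] (hne : P ≠ ⊤)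
    (hmax : ∀ Q : Subgroup G, Q.Normal → P ≤ Q → Q = P ∨ Q = ⊤) : IsSimpleGroup (G ⧸ P) := by
  haveI : Nontrivial (G ⧸ P) := by
    rw [QuotientGroup.nontrivial_iff]
    exact hne
  refine IsSimpleGroup.mk fun N hN => ?_
  have hPQ : P ≤ N.comap (QuotientGroup.mk' P) := by
    intro x hx
    rw [Subgroup.mem_comap, QuotientGroup.mk'_apply, (QuotientGroup.eq_one_iff x).2 hx]
    exact N.one_mem
  have hNeq : (N.comap (QuotientGroup.mk' P)).map (QuotientGroup.mk' P) = N :=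
    Subgroup.map_comap_eq_self_of_surjective (QuotientGroup.mk'_surjective P) N
  rcases hmax _ inferInstance hPQ with h | h
  · left
    rw [← hNeq, h, Subgroup.map_eq_bot_iff, QuotientGroup.ker_mk']
  · right
    rw [← hNeq, h, Subgroup.map_top_of_surjective _ (QuotientGroup.mk'_surjective P)]

/-- A quotient by a normal subgroup not containing the commutator subgroup is not commutative.
[folklore] -/
theorem not_isMulCommutative_quotient (P : Subgroup G) [P.Normal]
    (h : ¬ ⁅(⊤ : Subgroup G), (⊤ : Subgroup G)⁆ ≤ P) : ¬ IsMulCommutative (G ⧸ P) := by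
  intro hc
  apply h
  rw [Subgroup.commutator_le]
  intro a _ b _
  rw [← QuotientGroup.eq_one_iff, ← QuotientGroup.mk'_apply, map_commutatorElement,
    commutatorElement_eq_one_iff_mul_comm]
  exact hc.is_comm.comm _ _

/-- Chinese remainder for two normal subgroups with `P ⊔ P' = ⊤`. [folklore] -/
theorem exists_mk_eq_mk_eq (P P' : Subgroup G) [P.Normal] [P'.Normal] (h : P ⊔ P' = ⊤)
    (a b : G) : ∃ g : G, (QuotientGroup.mk' P g = QuotientGroup.mk' P a) ∧
      (QuotientGroup.mk' P' g = QuotientGroup.mk' P' b) := by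
  have hmem : a⁻¹ * b ∈ ((P ⊔ P' : Subgroup G) : Set G) := by
    rw [h]; exact Set.mem_univ _
  rw [Subgroup.normal_mul] at hmem
  obtain ⟨p, hp, p', hp', hpp⟩ := Set.mem_mul.1 hmem
  refine ⟨a * p, ?_, ?_⟩
  · rw [QuotientGroup.mk'_apply, QuotientGroup.mk'_apply, QuotientGroup.eq]
    simpa using hp
  · rw [QuotientGroup.mk'_apply, QuotientGroup.mk'_apply, QuotientGroup.eq]
    have : (a * p)⁻¹ * b = p' := by
      rw [mul_inv_rev, mul_assoc, ← hpp, inv_mul_cancel_left]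
    rw [this]
    exact hp'

/-- Images of maximal normal overgroups of a characteristic `M` under an automorphism. [folklore] -/
theorem maxNormal_map (M : Subgroup G) (hM : M.Characteristic) (φ : G ≃* G) {P : Subgroup G}
    (hP : P.Normal ∧ M ≤ P ∧ P ≠ ⊤ ∧ ∀ Q : Subgroup G, Q.Normal → P ≤ Q → Q = P ∨ Q = ⊤) :
    (P.map φ.toMonoidHom).Normal ∧ M ≤ P.map φ.toMonoidHom ∧ P.map φ.toMonoidHom ≠ ⊤ ∧
      ∀ Q : Subgroup G, Q.Normal → P.map φ.toMonoidHom ≤ Q → Q = P.map φ.toMonoidHom ∨ Q = ⊤ := by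
  obtain ⟨hn, hle, hne, hmax⟩ := hP
  haveI := hn
  refine ⟨Subgroup.Normal.map hn _ φ.surjective, ?_, ?_, ?_⟩
  · calc M = M.map φ.toMonoidHom := ((Subgroup.characteristic_iff_map_eq.1 hM) φ).symm
      _ ≤ P.map φ.toMonoidHom := Subgroup.map_mono hle
  · intro htop
    apply hne
    have := congrArg (Subgroup.comap φ.toMonoidHom) htop
    rwa [Subgroup.comap_map_eq_self_of_injective φ.injective, Subgroup.comap_top] at this
  · intro Q hQ hPQ
    haveI := hQ
    have hs : Function.Surjective φ.toMonoidHom := φ.surjective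
    have hQ' : (Q.comap φ.toMonoidHom).Normal := inferInstance
    have hPQ' : P ≤ Q.comap φ.toMonoidHom := fun x hx => by
      rw [Subgroup.mem_comap]
      exact hPQ ⟨x, hx, rfl⟩
    rcases hmax _ hQ' hPQ' with h | h
    · left
      rw [← Subgroup.map_comap_eq_self_of_surjective hs Q]
      exact congrArg _ h
    · right
      rw [← Subgroup.map_comap_eq_self_of_surjective hs Q, h,
        Subgroup.map_top_of_surjective _ hs]


/-- **Venn lemma, plain form**: two `Fin 3`-families of finsets with equal single and pairwise
cell sizes and empty triple cells are carried to each other by SOME permutation (from the landed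
fibre-count lemmas of the even form). [folklore] -/
theorem vennPerm {α : Type} [Fintype α] [DecidableEq α] (A B : Fin 3 → Finset α)
    (hcard : ∀ i, (A i).card = (B i).card) (hinter : ∀ i j, (A i ∩ A j).card = (B i ∩ B j).card)
    (hA : A 0 ∩ A 1 ∩ A 2 = ∅) (hB : B 0 ∩ B 1 ∩ B 2 = ∅) :
    ∃ σ : Equiv.Perm α, ∀ i, (A i).image σ = B i := by
  obtain ⟨σ, hσ⟩ := exists_perm_comp_eq_of_card_fiber_eq
    (fun x : α => fun i : Fin 3 => decide (x ∈ A i)) (fun x => fun i => decide (x ∈ B i))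
    (card_fiber_memVec_eq A B hcard hinter hA hB)
  refine ⟨σ, fun i => image_eq_of_mem_iff _ _ σ fun x => ?_⟩
  have := congrFun (hσ x) i
  simpa using this

end General

section Perm

variable {β : Type} [Fintype β] [DecidableEq β]

/-- **A subgroup of permutations realising every 3-cycle pointwise contains the alternating group.**
[folklore] -/
theorem alternatingGroup_le_of_threeCycles_realised (R : Subgroup (Equiv.Perm β))
    (h3 : ∀ a b c : β, a ≠ b → b ≠ c → a ≠ c → ∃ τ ∈ R, τ a = b ∧ τ b = c ∧ τ c = a ∧
      ∀ x : β, x ≠ a → x ≠ b → x ≠ c → τ x = x) :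
    alternatingGroup β ≤ R := by
  rw [← Equiv.Perm.closure_three_cycles_eq_alternating]
  refine (Subgroup.closure_le R).2 fun σ hσ => ?_
  have hσ' : σ.IsThreeCycle := hσ
  obtain ⟨a, ha⟩ : σ.support.Nonempty := by
    rw [← Finset.card_pos, hσ'.card_support]; norm_num
  have hsupp : σ.support = {a, σ a, σ (σ a)} := (hσ'.support_eq_iff_mem_support).2 ha
  have ha1 : σ a ≠ a := Equiv.Perm.mem_support.1 ha
  have ha2 : σ (σ a) ≠ σ a := fun h => ha1 (σ.injective h)
  have hcube : σ (σ (σ a)) = a := by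
    have : (σ ^ 3) a = a := by rw [← hσ'.orderOf, pow_orderOf_eq_one]; rfl
    simpa [pow_succ, Equiv.Perm.mul_apply] using this
  have ha3 : σ (σ a) ≠ a := by
    intro h
    apply ha1
    calc σ a = σ (σ (σ a)) := by rw [h]
      _ = a := hcube
  obtain ⟨τ, hτR, h1, h2, h3', hfix⟩ := h3 a (σ a) (σ (σ a)) ha1.symm ha2.symm ha3.symm
  have hστ : σ = τ := by
    ext x
    by_cases hxa : x = a
    · subst hxa; rw [h1]
    by_cases hxb : x = σ a
    · subst hxb; rw [h2]
    by_cases hxc : x = σ (σ a)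
    · subst hxc; rw [hcube, h3']
    · have hx : x ∉ σ.support := by
        rw [hsupp]
        simp [hxa, hxb, hxc]
      rw [Equiv.Perm.notMem_support.1 hx, hfix x hxa hxb hxc]
  rw [hστ]
  exact hτR

/-- **REGISTERED HELPER `helper_threeCyclesRealised`** (`∀`-form of
`alternatingGroup_le_of_threeCycles_realised`). [folklore] -/
theorem helper_threeCyclesRealised :
    ∀ (β : Type) [Fintype β] [DecidableEq β] (R : Subgroup (Equiv.Perm β)),
      (∀ a b c : β, a ≠ b → b ≠ c → a ≠ c → ∃ τ ∈ R, τ a = b ∧ τ b = c ∧ τ c = a ∧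
        ∀ x : β, x ≠ a → x ≠ b → x ≠ c → τ x = x) →
      alternatingGroup β ≤ R :=
  fun _ _ _ R h3 => alternatingGroup_le_of_threeCycles_realised R h3

/-- **On at most two points a transitive subgroup of permutations is everything.** [folklore] -/
theorem eq_top_of_card_le_two_of_transitive (R : Subgroup (Equiv.Perm β))
    (hcard : Fintype.card β ≤ 2) (htr : ∀ a b : β, ∃ τ ∈ R, τ a = b) : R = ⊤ := by
  have hthird : ∀ a b x : β, a ≠ b → x ≠ a → x ≠ b → False := by
    intro a b x hab hxa hxb
    have h3 : 3 ≤ Fintype.card β := by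
      have : ({a, b, x} : Finset β).card = 3 := by
        rw [Finset.card_insert_of_notMem, Finset.card_insert_of_notMem, Finset.card_singleton]
        · simpa using fun h => hxb h.symm
        · simp only [Finset.mem_insert, Finset.mem_singleton, not_or]
          exact ⟨hab, fun h => hxa h.symm⟩
      calc 3 = ({a, b, x} : Finset β).card := this.symm
        _ ≤ Fintype.card β := Finset.card_le_univ _
    omega
  have hswap : ∀ σ : Equiv.Perm β, σ.IsSwap → σ ∈ R := by
    rintro σ ⟨a, b, hab, rfl⟩
    obtain ⟨τ, hτR, hτ⟩ := htr a b
    have hτb : τ b = a := by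
      by_contra hna
      have hne : τ b ≠ b := fun h => hab (τ.injective (hτ.trans h.symm))
      exact hthird a b (τ b) hab hna hne
    have : Equiv.swap a b = τ := by
      ext x
      by_cases hxa : x = a
      · subst hxa; rw [Equiv.swap_apply_left, hτ]
      by_cases hxb : x = b
      · subst hxb; rw [Equiv.swap_apply_right, hτb]
      · exact (hthird a b x hab hxa hxb).elim
    rw [this]
    exact hτR
  rw [eq_top_iff, ← Equiv.Perm.closure_isSwap]
  exact (Subgroup.closure_le R).2 fun σ hσ => hswap σ hσ

end Perm

end Summit.SmoothPoincare4.SmoothPoincare4.Theorems.ShadowsStandard.PrymLayerStableRank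

end
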